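import Literature.MathematicalPhysics.QuantumFieldTheory.Balaban1983to89.B9Eq39Adjoint
import HarnessLib

/-!
# Line «poincare_lipschitz» on crux `HistoryTailL` (stmt-QuantumFields-19936), route crux `BlockLipschitzL` (stmt-QuantumFields-23533), K2 supplier plan,
# (R3)-COV — «COV-CURL-OF-RATIO»: THE COVARIANT CURL OF THE RATIO CHART `A = W·V⁻¹ − 1` IS THE DIFFERENCE OF THE TWO PLAQUETTE VARIABLES UP TO
# SECOND ORDER — `curl_V A (p) = (W(∂p) − V(∂p)) − a₁a₂ + a₄a₃ − (a₁ + a₂ + a₁a₂)(V(∂p) − 1) + (W(∂p) − 1)(a₄ + a₃ + a₄a₃)` EXACTLY, hence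
# `‖curl_V A (p)‖ ≤ (θ_V + θ_W)(1 + 2s + s²) + 2s²` when `‖V(∂p) − 1‖ ≤ θ_V`, `‖W(∂p) − 1‖ ≤ θ_W`, `‖A‖ ≤ s` on `∂p` — the `κ`-slot of the (R3)-COV row
# fed from «BOTH FIELDS GOOD», any lattice, any non-expanding transport

Cell `ym3-torus` (YM ladder rung R3 = continuum SU(2) Yang–Mills on the three-torus — a RUNG, NOT the Clay problem: not d = 4, not infinite volume, not a
mass gap); width seat `ym-ust-19936-w5` gen 11 (bus 2026-08-29T02:0xZ «COV-CURL-OF-RATIO»; LEAD ym-ust-19936-w1 g7 card v1.25 (c) (R3) «U-div-free ∧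
curl-small (both fields good)», v1.30 «deep regime = covariant Campanato road + ALIGN»; F6 pen = LEAD).  THEOREMS ONLY (def-free), in the letters of
✓`B9Eq39Adjoint` (`R`, `covD`, `curl`, `plaqU` over an abstract lattice `T : ι → Equiv.Perm S`); `--supports stmt-QuantumFields-19936`.  Nothing here proves
`hStab`, F6, a stub, `BlockLipschitzL`, `HistoryTailL` or a summit statement.

WHY.  The (R3)-COV row (✓`PoincareLipschitzCovariantOneFormMeanValue.normSq_le_of_cov_curl_div_hol`, px7; on the torus ✓`PoincareLipschitzCovariantBridge`,
★w5 g11) bounds the sup of a 1-form `A` by its box `ℓ²`-mass plus `R²·(κ + δ + R·θ·S)²`, where `κ` bounds the COVARIANT CURL `curl_V A`.  In the K2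
tower (✓p686171∕✓p686808, F6) the 1-form is the ratio chart `A_b = pertVar V W b = W_b·V_b⁻¹ − 1` of two fields whose plaquette variables are both within
the windows (`‖V(∂p) − 1‖ ≤ θ_V`, `‖W(∂p) − 1‖ ≤ θ_W`).  This file supplies `κ` from exactly that: the plaquette variables of `W = (1 + A)·V` and `V` satisfy
`W(∂p)·(1 + a₄)(1 + a₃) = (1 + a₁)(1 + a₂)·V(∂p)` with the TRANSPORTED letters `a₁ = A_μ(x)`, `a₂ = R(V_μ(x))A_ν(x+e_μ)`, `a₃ = R(V_ν(x))A_μ(x+e_ν)`,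
`a₄ = A_ν(x)` (`R(U)X = UXU⁻¹`), and `a₁ + a₂ − a₃ − a₄` IS `curl_V A` — so the curl is the difference of the plaquette variables up to quadratic terms.
No exponential chart, no inverse of `1 + A`, no smallness needed for the identity.

* §1 `plaq_ratio_identity` — the EXACT unit identity `W(∂p)·((1 + a₄)(1 + a₃)) = ((1 + a₁)(1 + a₂))·V(∂p)`; ★★ `curl_eq_plaq_sub_plaq_add` — the displayed
  exact formula for `curl_V A`.
* §2 ★★★ `norm_curl_ratio_le` — `‖curl_V A(x;μ,ν)‖ ≤ (θ_V + θ_W)·(1 + 2s + s²) + 2s²` for non-expanding transports `‖R(V_μ x)X‖, ‖R(V_ν x)X‖ ≤ ‖X‖`.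
[folklore] ([Balaban1985BackgroundPropagators] (3.1)–(3.6) pp.390–391 is the print locus of the plaquette expansion around a background; here in the ratio
chart and to first order only).
-/

set_option autoImplicit false

namespace Summit.QuantumFields.YangMills.Theorems.PoincareLipschitzCovariantCurlOfRatio

open Literature.MathematicalPhysics.QuantumFieldTheory.Balaban1983to89
open B9Eq39Adjoint (R R_def covD curl plaqU)

variable {𝔸 : Type*} [NormedRing 𝔸] {S : Type*} {ι : Type*} (T : ι → Equiv.Perm S)

/-! ## §1 The exact plaquette identity in the ratio chart -/

/-- **THE PLAQUETTE IDENTITY OF THE RATIO CHART**: if `W_b = (1 + A_b)·V_b` on the four bonds of the plaquette `p = (x; μ, ν)`, then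
`W(∂p)·((1 + A_ν(x))(1 + R(V_ν x)A_μ(x+e_ν))) = ((1 + A_μ(x))(1 + R(V_μ x)A_ν(x+e_μ)))·V(∂p)`
(`W_μ(x)W_ν(x+e_μ) = (1+a₁)(1+a₂)V_μ(x)V_ν(x+e_μ)`, `W_ν(x)W_μ(x+e_ν) = (1+a₄)(1+a₃)V_ν(x)V_μ(x+e_ν)`, and `U(∂p) = U_μU_ν(U_νU_μ)⁻¹`). [folklore]
[cite: Balaban1985BackgroundPropagators, (3.1)-(3.2) p.390] -/
theorem plaq_ratio_identity (V W : ι → S → 𝔸ˣ) (A : ι → S → 𝔸) (μ ν : ι) (x : S)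
    (h₁ : (W μ x : 𝔸) = (1 + A μ x) * V μ x) (h₂ : (W ν (T μ x) : 𝔸) = (1 + A ν (T μ x)) * V ν (T μ x))
    (h₃ : (W μ (T ν x) : 𝔸) = (1 + A μ (T ν x)) * V μ (T ν x)) (h₄ : (W ν x : 𝔸) = (1 + A ν x) * V ν x) :
    (plaqU T W μ ν x : 𝔸) * ((1 + A ν x) * (1 + R (V ν x) (A μ (T ν x)))) =
      ((1 + A μ x) * (1 + R (V μ x) (A ν (T μ x)))) * (plaqU T V μ ν x : 𝔸) := by
  -- the two half-contours
  have hW12 : (W μ x : 𝔸) * W ν (T μ x) = ((1 + A μ x) * (1 + R (V μ x) (A ν (T μ x)))) * ((V μ x : 𝔸) * V ν (T μ x)) := by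
    rw [h₁, h₂, R_def]
    have : (V μ x : 𝔸) * (1 + A ν (T μ x)) = (1 + (V μ x : 𝔸) * A ν (T μ x) * ((V μ x)⁻¹ : 𝔸ˣ)) * V μ x := by
      rw [add_mul, one_mul, mul_add, mul_one, Units.inv_mul_cancel_right]
    calc (1 + A μ x) * (V μ x : 𝔸) * ((1 + A ν (T μ x)) * V ν (T μ x))
        = (1 + A μ x) * ((V μ x : 𝔸) * (1 + A ν (T μ x))) * V ν (T μ x) := by simp only [mul_assoc]
      _ = _ := by rw [this]; simp only [mul_assoc]
  have hW43 : (W ν x : 𝔸) * W μ (T ν x) = ((1 + A ν x) * (1 + R (V ν x) (A μ (T ν x)))) * ((V ν x : 𝔸) * V μ (T ν x)) := by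
    rw [h₄, h₃, R_def]
    have : (V ν x : 𝔸) * (1 + A μ (T ν x)) = (1 + (V ν x : 𝔸) * A μ (T ν x) * ((V ν x)⁻¹ : 𝔸ˣ)) * V ν x := by
      rw [add_mul, one_mul, mul_add, mul_one, Units.inv_mul_cancel_right]
    calc (1 + A ν x) * (V ν x : 𝔸) * ((1 + A μ (T ν x)) * V μ (T ν x))
        = (1 + A ν x) * ((V ν x : 𝔸) * (1 + A μ (T ν x))) * V μ (T ν x) := by simp only [mul_assoc]
      _ = _ := by rw [this]; simp only [mul_assoc]
  -- `plaqU U = (U₁U₂)·(U₄U₃)⁻¹`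
  have hpW : (plaqU T W μ ν x : 𝔸) * ((W ν x : 𝔸) * W μ (T ν x)) = (W μ x : 𝔸) * W ν (T μ x) := by
    simp only [plaqU, Units.val_mul, mul_assoc, Units.inv_mul_cancel_left, Units.inv_mul]
    rw [mul_one]
  have hpV : (plaqU T V μ ν x : 𝔸) * ((V ν x : 𝔸) * V μ (T ν x)) = (V μ x : 𝔸) * V ν (T μ x) := by
    simp only [plaqU, Units.val_mul, mul_assoc, Units.inv_mul_cancel_left, Units.inv_mul]
    rw [mul_one]
  -- cancel the unit `V₄V₃` on the right
  have key : (plaqU T W μ ν x : 𝔸) * ((1 + A ν x) * (1 + R (V ν x) (A μ (T ν x)))) * ((V ν x : 𝔸) * V μ (T ν x)) =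
      ((1 + A μ x) * (1 + R (V μ x) (A ν (T μ x)))) * (plaqU T V μ ν x : 𝔸) * ((V ν x : 𝔸) * V μ (T ν x)) := by
    rw [mul_assoc, ← hW43, hpW, hW12, ← hpV, mul_assoc ((1 + A μ x) * (1 + R (V μ x) (A ν (T μ x)))) (plaqU T V μ ν x : 𝔸)]
  have hunit : ((V ν x : 𝔸) * V μ (T ν x)) * ((((V μ (T ν x))⁻¹ : 𝔸ˣ) : 𝔸) * (((V ν x)⁻¹ : 𝔸ˣ) : 𝔸)) = 1 := by
    rw [mul_assoc, Units.mul_inv_cancel_left, Units.mul_inv]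
  calc (plaqU T W μ ν x : 𝔸) * ((1 + A ν x) * (1 + R (V ν x) (A μ (T ν x))))
      = (plaqU T W μ ν x : 𝔸) * ((1 + A ν x) * (1 + R (V ν x) (A μ (T ν x)))) * ((V ν x : 𝔸) * V μ (T ν x)) *
          ((((V μ (T ν x))⁻¹ : 𝔸ˣ) : 𝔸) * (((V ν x)⁻¹ : 𝔸ˣ) : 𝔸)) := by rw [mul_assoc _ ((V ν x : 𝔸) * _), hunit, mul_one]
    _ = ((1 + A μ x) * (1 + R (V μ x) (A ν (T μ x)))) * (plaqU T V μ ν x : 𝔸) * ((V ν x : 𝔸) * V μ (T ν x)) *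
          ((((V μ (T ν x))⁻¹ : 𝔸ˣ) : 𝔸) * (((V ν x)⁻¹ : 𝔸ˣ) : 𝔸)) := by rw [key]
    _ = ((1 + A μ x) * (1 + R (V μ x) (A ν (T μ x)))) * (plaqU T V μ ν x : 𝔸) := by rw [mul_assoc _ ((V ν x : 𝔸) * _), hunit, mul_one]

/-- ★★ **THE COVARIANT CURL OF THE RATIO CHART, EXACTLY**: with `a₁ = A_μ(x)`, `a₂ = R(V_μ x)A_ν(x+e_μ)`, `a₃ = R(V_ν x)A_μ(x+e_ν)`, `a₄ = A_ν(x)`,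
`P = V(∂p)`, `Q = W(∂p)`: `curl_V A(x;μ,ν) = a₁ + a₂ − a₃ − a₄ = (Q − P) − a₁a₂ + a₄a₃ − (a₁ + a₂ + a₁a₂)(P − 1) + (Q − 1)(a₄ + a₃ + a₄a₃)`.
[folklore] [cite: Balaban1985BackgroundPropagators, (3.4)-(3.6) p.391] -/
theorem curl_eq_plaq_sub_plaq_add (V W : ι → S → 𝔸ˣ) (A : ι → S → 𝔸) (μ ν : ι) (x : S)
    (h₁ : (W μ x : 𝔸) = (1 + A μ x) * V μ x) (h₂ : (W ν (T μ x) : 𝔸) = (1 + A ν (T μ x)) * V ν (T μ x))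
    (h₃ : (W μ (T ν x) : 𝔸) = (1 + A μ (T ν x)) * V μ (T ν x)) (h₄ : (W ν x : 𝔸) = (1 + A ν x) * V ν x) :
    curl T V A μ ν x =
      ((plaqU T W μ ν x : 𝔸) - (plaqU T V μ ν x : 𝔸)) - A μ x * R (V μ x) (A ν (T μ x)) + A ν x * R (V ν x) (A μ (T ν x)) -
        (A μ x + R (V μ x) (A ν (T μ x)) + A μ x * R (V μ x) (A ν (T μ x))) * ((plaqU T V μ ν x : 𝔸) - 1) +
        ((plaqU T W μ ν x : 𝔸) - 1) * (A ν x + R (V ν x) (A μ (T ν x)) + A ν x * R (V ν x) (A μ (T ν x))) := by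
  have key := plaq_ratio_identity T V W A μ ν x h₁ h₂ h₃ h₄
  have hcurl : curl T V A μ ν x = A μ x + R (V μ x) (A ν (T μ x)) - R (V ν x) (A μ (T ν x)) - A ν x := by
    simp only [curl, covD]; abel
  rw [hcurl]
  -- move everything to one side and use the identity
  have e : (plaqU T W μ ν x : 𝔸) * ((1 + A ν x) * (1 + R (V ν x) (A μ (T ν x)))) -
      ((1 + A μ x) * (1 + R (V μ x) (A ν (T μ x)))) * (plaqU T V μ ν x : 𝔸) = 0 := by rw [key, sub_self]
  have expand : (plaqU T W μ ν x : 𝔸) * ((1 + A ν x) * (1 + R (V ν x) (A μ (T ν x)))) -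
      ((1 + A μ x) * (1 + R (V μ x) (A ν (T μ x)))) * (plaqU T V μ ν x : 𝔸) =
      (((plaqU T W μ ν x : 𝔸) - (plaqU T V μ ν x : 𝔸)) - A μ x * R (V μ x) (A ν (T μ x)) + A ν x * R (V ν x) (A μ (T ν x)) -
        (A μ x + R (V μ x) (A ν (T μ x)) + A μ x * R (V μ x) (A ν (T μ x))) * ((plaqU T V μ ν x : 𝔸) - 1) +
        ((plaqU T W μ ν x : 𝔸) - 1) * (A ν x + R (V ν x) (A μ (T ν x)) + A ν x * R (V ν x) (A μ (T ν x)))) -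
      (A μ x + R (V μ x) (A ν (T μ x)) - R (V ν x) (A μ (T ν x)) - A ν x) := by
    noncomm_ring
  rw [expand] at e
  exact (sub_eq_zero.mp e).symm

/-! ## §2 The size of the covariant curl from the two plaquette windows -/

/-- ★★★ **THE `κ`-SLOT FROM «BOTH FIELDS GOOD»**: if `W_b = (1 + A_b)·V_b` on the four bonds of `p = (x; μ, ν)`, the transports `R(V_μ x)`, `R(V_ν x)` do not
increase the norm (unitary backgrounds), `‖A_b‖ ≤ s` on the four bonds, `‖V(∂p) − 1‖ ≤ θ_V` and `‖W(∂p) − 1‖ ≤ θ_W`, then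
`‖curl_V A(x;μ,ν)‖ ≤ (θ_V + θ_W)·(1 + 2s + s²) + 2s²`.  NO smallness hypothesis. [folklore] [cite: Balaban1985BackgroundPropagators, (3.4)-(3.6) p.391] -/
theorem norm_curl_ratio_le (V W : ι → S → 𝔸ˣ) (A : ι → S → 𝔸) (μ ν : ι) (x : S)
    (h₁ : (W μ x : 𝔸) = (1 + A μ x) * V μ x) (h₂ : (W ν (T μ x) : 𝔸) = (1 + A ν (T μ x)) * V ν (T μ x))
    (h₃ : (W μ (T ν x) : 𝔸) = (1 + A μ (T ν x)) * V μ (T ν x)) (h₄ : (W ν x : 𝔸) = (1 + A ν x) * V ν x)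
    (hRμ : ∀ X : 𝔸, ‖R (V μ x) X‖ ≤ ‖X‖) (hRν : ∀ X : 𝔸, ‖R (V ν x) X‖ ≤ ‖X‖)
    {s θV θW : ℝ} (hs0 : 0 ≤ s) (hs₁ : ‖A μ x‖ ≤ s) (hs₂ : ‖A ν (T μ x)‖ ≤ s) (hs₃ : ‖A μ (T ν x)‖ ≤ s) (hs₄ : ‖A ν x‖ ≤ s)
    (hθV : ‖(plaqU T V μ ν x : 𝔸) - 1‖ ≤ θV) (hθW : ‖(plaqU T W μ ν x : 𝔸) - 1‖ ≤ θW) :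
    ‖curl T V A μ ν x‖ ≤ (θV + θW) * (1 + 2 * s + s ^ 2) + 2 * s ^ 2 := by
  rw [curl_eq_plaq_sub_plaq_add T V W A μ ν x h₁ h₂ h₃ h₄]
  set a₁ := A μ x
  set a₂ := R (V μ x) (A ν (T μ x))
  set a₃ := R (V ν x) (A μ (T ν x))
  set a₄ := A ν x
  set Pv : 𝔸 := (plaqU T V μ ν x : 𝔸)
  set Qw : 𝔸 := (plaqU T W μ ν x : 𝔸)
  have ha₂ : ‖a₂‖ ≤ s := (hRμ _).trans hs₂
  have ha₃ : ‖a₃‖ ≤ s := (hRν _).trans hs₃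
  have hθV0 : 0 ≤ θV := (norm_nonneg _).trans hθV
  have hθW0 : 0 ≤ θW := (norm_nonneg _).trans hθW
  have hQP : ‖Qw - Pv‖ ≤ θW + θV := by
    have : Qw - Pv = (Qw - 1) - (Pv - 1) := by abel
    rw [this]; exact (norm_sub_le _ _).trans (add_le_add hθW hθV)
  have h12 : ‖a₁ * a₂‖ ≤ s * s := (norm_mul_le _ _).trans (mul_le_mul hs₁ ha₂ (norm_nonneg _) hs0)
  have h43 : ‖a₄ * a₃‖ ≤ s * s := (norm_mul_le _ _).trans (mul_le_mul hs₄ ha₃ (norm_nonneg _) hs0)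
  have hb₁ : ‖a₁ + a₂ + a₁ * a₂‖ ≤ s + s + s * s := (norm_add₃_le).trans (add_le_add (add_le_add hs₁ ha₂) h12)
  have hb₄ : ‖a₄ + a₃ + a₄ * a₃‖ ≤ s + s + s * s := (norm_add₃_le).trans (add_le_add (add_le_add hs₄ ha₃) h43)
  have hT1 : ‖(a₁ + a₂ + a₁ * a₂) * (Pv - 1)‖ ≤ (s + s + s * s) * θV :=
    (norm_mul_le _ _).trans (mul_le_mul hb₁ hθV (norm_nonneg _) (by positivity))
  have hT2 : ‖(Qw - 1) * (a₄ + a₃ + a₄ * a₃)‖ ≤ θW * (s + s + s * s) :=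
    (norm_mul_le _ _).trans (mul_le_mul hθW hb₄ (norm_nonneg _) hθW0)
  calc ‖Qw - Pv - a₁ * a₂ + a₄ * a₃ - (a₁ + a₂ + a₁ * a₂) * (Pv - 1) + (Qw - 1) * (a₄ + a₃ + a₄ * a₃)‖
      ≤ ‖Qw - Pv‖ + ‖a₁ * a₂‖ + ‖a₄ * a₃‖ + ‖(a₁ + a₂ + a₁ * a₂) * (Pv - 1)‖ + ‖(Qw - 1) * (a₄ + a₃ + a₄ * a₃)‖ := by
        have e : Qw - Pv - a₁ * a₂ + a₄ * a₃ - (a₁ + a₂ + a₁ * a₂) * (Pv - 1) + (Qw - 1) * (a₄ + a₃ + a₄ * a₃) =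
            (Qw - Pv) + (-(a₁ * a₂)) + a₄ * a₃ + (-((a₁ + a₂ + a₁ * a₂) * (Pv - 1))) + (Qw - 1) * (a₄ + a₃ + a₄ * a₃) := by abel
        rw [e]
        refine (norm_add_le _ _).trans (add_le_add ((norm_add_le _ _).trans (add_le_add ((norm_add_le _ _).trans (add_le_add
          ((norm_add_le _ _).trans (add_le_add le_rfl (by rw [norm_neg]))) le_rfl)) (by rw [norm_neg]))) le_rfl)
    _ ≤ (θW + θV) + s * s + s * s + (s + s + s * s) * θV + θW * (s + s + s * s) := by linarith [hQP, h12, h43, hT1, hT2]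
    _ = (θV + θW) * (1 + 2 * s + s ^ 2) + 2 * s ^ 2 := by ring

end Summit.QuantumFields.YangMills.Theorems.PoincareLipschitzCovariantCurlOfRatio
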